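import Mathlib.FieldTheory.IsAlgClosed.Basic
import Mathlib.Tactic.IntervalCases
import Literature.AlgebraicGeometry.Motives.Cycles
import Literature.AlgebraicGeometry.Motives.Varieties
import Literature.AlgebraicGeometry.HodgeTheory.HodgeConjecture
import HarnessLib

/-!
# Varieties with small Chow groups satisfy the Hodge conjecture (Laterveer 1998; Vial 2013, Thm. 7.1 (i))

Named fact (D-0014), family `hodge`, layer `Literature/AlgebraicGeometry/HodgeTheory`.

Source READ: Ch. Vial, *Algebraic cycles and fibrations*, Doc. Math. 18 (2013) 1521–1553
(= arXiv:1203.2650, "Algebraic cycles on smooth varieties fibred by varieties with small Chow groups"),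
§7.1, verbatim (materialised text, p. 19): "In this section, we review the known results about varieties
with Chow groups having small niveau; see Definition (D:niveau). Varieties are defined over an
algebraically closed field `k` of characteristic zero and `Ω` denotes a universal domain over `k`. […]
**Theorem 7.1.** Let `X` be a smooth projective variety of dimension `d`. Assume that the Chow groups
`CH₀(X_Ω), …, CH_l(X_Ω)` have niveau `≤ n`.
• If `n = 3` and `l = ⌊(d−4)/2⌋`, then `X` satisfies the Hodge conjecture.
• If `n = 2` and `l = ⌊(d−3)/2⌋`, then `X` satisfies the Lefschetz standard conjecture.
• If `n = 1` and `l = ⌊(d−3)/2⌋`, then `X` has a Murre decomposition.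
• If `n = 1` and `l = ⌊(d−2)/2⌋`, then `X` is Kimura finite-dimensional.
Proof. […] The first item is proved in [Laterveer]." — [Laterveer] = R. Laterveer, *Algebraic varieties
with small Chow groups*, J. Math. Kyoto Univ. 38 (1998) 673–694 (not held, acquisition `acq-01562`; the
statement is vendored from Vial's citation of it, whence the double `cite`). Conventions of the source
(Notations, p. 3): "the group `CH_i(X)` is the `ℚ`-vector space with basis the `i`-dimensional irreducible
reduced subschemes of `X` modulo rational equivalence"; (§1, p. 2, after Laterveer) `CH_i(X)` has
*niveau `≤ n`* when it is supported on a closed subscheme of dimension `≤ i + n`, i.e. the push-forward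
`CH_i(Z_Ω) → CH_i(X_Ω)` from such a `Z` is surjective.

Printed application in the same paper, §7.2.4 (p. 20): "Let `X ⊂ Pⁿ` be the complete intersection of a
quadric and of a cubic. If `dim X ≥ 6`, then Hirschowitz and Iyer [HI] showed `CH_l(X) = ℚ` for `l ≤ 1`"
(whence Prop. 7.7: the Hodge conjecture for smooth projective varieties fibred in such sixfolds over a
curve).

## Lean rendering (real definitions of the tree only)

We vendor item (i) with the niveau hypothesis in the special — and for the consumers sufficient — form
"niveau `0` because of rank `≤ 1`": for every `i ≤ ⌊(d−4)/2⌋`, ANY two classes of the tree's integral Chow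
group `Motives.ChowGroup (X_L).left i` (`Motives/Cycles`: `i`-cycles modulo `Rat_i`) of the base change
`X_L := (Motives.baseChange ℂ L).obj X` (`Motives/Varieties`) are `ℤ`-linearly dependent,
`∃ (m, n) ≠ (0, 0), m • a = n • b`, i.e. `CH_i(X_L) ⊗ ℚ` has dimension `≤ 1`; it is then `0` or spanned by
the class of one `i`-cycle, hence supported on an `i`-dimensional closed subset — niveau `≤ 0 ≤ 3`. We ask
this for EVERY algebraically closed field `L ⊇ ℂ` (`[Field L] [IsAlgClosed L] [Algebra ℂ L]`), which is a
priori more than "for a universal domain `Ω ⊇ k`" (any universal domain over `k = ℂ` is such an `L`); a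
stronger hypothesis makes the rendered `Prop` a CONSEQUENCE of the printed theorem, never more. The
conclusion "`X` satisfies the Hodge conjecture" is the tree's `HodgeConjectureFor d X` (`k = ℂ`; rational
`(p,p)`-classes are algebraic, plus the anti-vacuity conjunct `Nonempty (HodgeModel d X)`, a theorem for
smooth projective `X`). For `d ≤ 4` the exponent `⌊(d−4)/2⌋` is `0` in `ℕ`, which can only ADD the
hypothesis on `CH₀` where print asks nothing (`d ≤ 3`) — again weaker than print.

grounds `Summit.HodgeConjecture.HodgeConjecture.Theses.SchlafliMinusFive.LadderHodgeSix` (`d = 6`,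
`l = 1`; NB that item assumes rank `≤ 1` over `ℂ` only — it is STRONGER than this rendering in that one
respect) and, combined with Hirschowitz–Iyer 2010 (`CH₁ ⊗ ℚ = ℚ` for `(2,3)` complete intersections of
dimension `≥ 6`, Vial §7.2.4) and Roitman 1972 / Esnault–Levine–Viehweg 1997 (`CH₀ ⊗ ℚ = ℚ`) applied to
`X_L`, the route target `Summit.HodgeConjecture.HodgeConjecture.Theses.SchlafliMinusFive.HodgeAllSmooth23`
(the Hodge conjecture for every smooth `(2,3)` complete-intersection sixfold in `P⁸_ℂ`).

## What is NOT here

* Items (ii)–(iv) of Thm. 7.1 (Lefschetz standard conjecture, Murre decomposition, Kimura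
  finite-dimensionality): no carriers needed by a consumer yet.
* Laterveer's general niveau-`≤ 3` hypothesis (needs push-forward surjectivity from a closed subscheme of
  `X_Ω` of dimension `≤ i + 3`; the tree's `ChowGroup.pushforward` is still conditional on
  `map_mem_ratTrivial`), and the notion of a universal domain.

## References

* [Vial2013] Ch. Vial, Algebraic cycles and fibrations, Doc. Math. 18 (2013) 1521–1553, Thm. 7.1 (i),
  §7.2.4, Prop. 7.7.
* [Laterveer1998] R. Laterveer, Algebraic varieties with small Chow groups, J. Math. Kyoto Univ. 38 (1998)
  673–694.
-/

noncomputable section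

open CategoryTheory

namespace Literature.AlgebraicGeometry.HodgeTheory

section HodgeTheory

/-- **Laterveer 1998 / Vial 2013, Thm. 7.1 (i)** ("Let `X` be a smooth projective variety of dimension
`d` [over an algebraically closed field `k` of characteristic zero, `Ω ⊇ k` a universal domain]. Assume
that the Chow groups `CH₀(X_Ω), …, CH_l(X_Ω)` have niveau `≤ n`. If `n = 3` and `l = ⌊(d−4)/2⌋`, then `X`
satisfies the Hodge conjecture"), rendered for `k = ℂ` with the niveau hypothesis in the rank-`≤ 1` form
(niveau `0`): if for every algebraically closed field `L ⊇ ℂ` and every `i ≤ ⌊(d−4)/2⌋` any two classes in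
`CH_i(X_L)` are `ℤ`-linearly dependent (`CH_i(X_L) ⊗ ℚ` of dimension `≤ 1`), then every rational
`(p,p)`-class on `X(ℂ)` is algebraic (`HodgeConjectureFor d X`). At most as strong as print (see the module
docstring). [cite: Vial2013, Thm 7.1 (i)] [cite: Laterveer1998, main theorem, as quoted in Vial2013 Thm 7.1] -/
def Vial2013_hodgeConjectureFor_of_chowGroups_rank_le_one : Prop :=
  ∀ ⦃d : ℕ⦄ ⦃X : Motives.SchemeOver ℂ⦄, Motives.IsSmoothProjective d X →
    (∀ (L : Type) [Field L] [IsAlgClosed L] [Algebra ℂ L] (i : ℕ), i ≤ (d - 4) / 2 →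
      ∀ a b : Motives.ChowGroup ((Motives.baseChange ℂ L).obj X).left i,
        ∃ m n : ℤ, (m ≠ 0 ∨ n ≠ 0) ∧ m • a = n • b) →
    HodgeConjectureFor d X

/-- Unfolding (restatement for consumers): the fact applied to a smooth projective `d`-fold with the
rank hypothesis yields `HodgeConjectureFor d X`. [cite: Vial2013, Thm 7.1 (i)] -/
theorem hodgeConjectureFor_of_chowGroups_rank_le_one
    (h : Vial2013_hodgeConjectureFor_of_chowGroups_rank_le_one) {d : ℕ} {X : Motives.SchemeOver ℂ}
    (hX : Motives.IsSmoothProjective d X)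
    (hCH : ∀ (L : Type) [Field L] [IsAlgClosed L] [Algebra ℂ L] (i : ℕ), i ≤ (d - 4) / 2 →
      ∀ a b : Motives.ChowGroup ((Motives.baseChange ℂ L).obj X).left i,
        ∃ m n : ℤ, (m ≠ 0 ∨ n ≠ 0) ∧ m • a = n • b) :
    HodgeConjectureFor d X :=
  h hX hCH

/-- Sanity (the sixfold case used by route `SchlafliMinusFive`): for `d = 6` the hypothesis ranges over
`i ≤ 1`, i.e. `CH₀` and `CH₁` of the base changes. [cite: Vial2013, Thm 7.1 (i)] -/
theorem hodgeConjectureFor_six_of_chowZero_chowOne_rank_le_one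
    (h : Vial2013_hodgeConjectureFor_of_chowGroups_rank_le_one) {X : Motives.SchemeOver ℂ}
    (hX : Motives.IsSmoothProjective 6 X)
    (h0 : ∀ (L : Type) [Field L] [IsAlgClosed L] [Algebra ℂ L],
      ∀ a b : Motives.ChowGroup ((Motives.baseChange ℂ L).obj X).left 0,
        ∃ m n : ℤ, (m ≠ 0 ∨ n ≠ 0) ∧ m • a = n • b)
    (h1 : ∀ (L : Type) [Field L] [IsAlgClosed L] [Algebra ℂ L],
      ∀ a b : Motives.ChowGroup ((Motives.baseChange ℂ L).obj X).left 1,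
        ∃ m n : ℤ, (m ≠ 0 ∨ n ≠ 0) ∧ m • a = n • b) :
    HodgeConjectureFor 6 X := by
  refine h hX fun L _ _ _ i hi a b => ?_
  have hi' : i ≤ 1 := by simpa using hi
  interval_cases i
  · exact h0 L a b
  · exact h1 L a b

end HodgeTheory

end Literature.AlgebraicGeometry.HodgeTheory

end
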